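import Literature.AlgebraicGeometry.Resolution.ImmediateRationalUniformization
import HarnessLib

/-!
# The choice of the centre in the normal form of Kuhlmann 2019, Lemma 4.2 ((4.10)–(4.11))

Topic: `Literature/AlgebraicGeometry/Resolution` (valued function fields). Second ingredient
(after `Kuhlmann2019Lemma42PElimination.lean`) of the hypothesis `(H42)` of
`Kuhlmann2019DegreePStepAssembly.lean` = the part of F.-V. Kuhlmann, *Elimination of
ramification II: Henselian rationality*, Israel J. Math. 234 (2019) = arXiv:1701.05508,
**Lemma 4.2** used in the proof of Prop. 4.8. Printed (p. 8):

> Since the approximation type of `x` over `K` is transcendental, we may choose `α₀ ∈ v(x − K)`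
> such that for all `c ∈ K` with `v(x − c) ≥ α₀` the value of `f(c)` as well as the values of
> (4.9) for `X₀ = c` are fixed, for all `j ≤ n` with `(p, j) = 1`. For those `c` we set (4.10)
> […] which is an element of the `p`-divisible hull of `vK`. As the set `{v(x − c) | c ∈ K}` has
> no greatest element, we may choose `c` with `v(x − c) ≥ α₀` such that all values (4.11) […]
> are distinct, nonzero, and not equal to `vf(c)`. Having chosen `c`, we choose `d ∈ K` such
> that `vd = v(x − c)` and put `z = (x − c)/d`.

This is the mechanism of Knaf–Kuhlmann 2009, Lemma 2.18 (`exists_center_taylor_valuation_ne`,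
`ImmediateRationalUniformization.lean`), for an arbitrary finite family of polynomials `G` over
`K` and arbitrary exponents: the values `v(g(c))`, `g ∈ G`, are eventually constant by the
transcendental approximation type (condition (3) of Knaf–Kuhlmann 2009, Lemma 2.17), the bad
values `γ = v(x − c)` — those with `v(g(c)) γ^m = v(g′(c)) γ^{m′}` for some `g, g′ ∈ G` and
exponents `m ≠ m′ ≤ M` — are finitely many, and infinitely many values `v(x − c)` are available
(Knaf–Kuhlmann 2009, Lemma 2.5). This file PROVES that statement (`exists_center_valuation_pow_ne`).

## Sources

* [K19] F.-V. Kuhlmann, Israel J. Math. 234 (2019) = arXiv:1701.05508: Lemma 4.2 (proof,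
  (4.9)–(4.11)), p. 8. [Kuhlmann2019]
* [KK09] H. Knaf, F.-V. Kuhlmann, Adv. Math. 221 (2009) = arXiv:math/0702856: Lemmas 2.5,
  2.17, 2.18. [KnafKuhlmann2009]

## Rendering notes

As in `ImmediateRationalUniformization.lean`: `(Ω, V)` one valued field, `K : Subfield Ω`,
`K(z) = Subfield.closure (K ∪ {z})`, "`K(z)|K` immediate" = `hval`, `hres`, transcendental
approximation type = `h3`; values multiplicative. No definition is introduced.
-/

noncomputable section

namespace Literature.AlgebraicGeometry.Resolution

universe u

open Polynomial

variable {Ω : Type u} [Field Ω] (V : ValuationSubring Ω) (K : Subfield Ω)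

/-- **The choice of the centre and the scale** (Kuhlmann 2019, proof of Lemma 4.2,
(4.10)–(4.11); Knaf–Kuhlmann 2009, Lemma 2.18). Let `z ∉ K` with `K(z)|K` immediate (`hval`,
`hres`) and of transcendental approximation type (`h3`), `G` a finite family of polynomials over
`K` and `M` a bound. Then there are `a ∈ K` and `b ∈ K^×` with `v(b) = v(z − a)` such that for
all `g, g′ ∈ G` with `g(a), g′(a) ≠ 0` and all exponents `m ≠ m′ ≤ M`:
`v(g(a))·v(b)^m ≠ v(g′(a))·v(b)^{m′}`. [cite: Kuhlmann2019, Lemma 4.2 (proof, (4.10)–(4.11))] -/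
theorem exists_center_valuation_pow_ne {z : Ω} (hzK : z ∉ K)
    (hval : ∀ w ∈ Subfield.closure ((K : Set Ω) ∪ {z}), w ≠ 0 → ∃ b ∈ K,
      V.valuation w = V.valuation b)
    (hres : ∀ w ∈ Subfield.closure ((K : Set Ω) ∪ {z}), w ∈ V → ∃ c ∈ K,
      V.valuation (w - c) < 1)
    (h3 : ∀ g : Polynomial Ω, (∀ k, g.coeff k ∈ K) → ∃ a₀ ∈ K, ∃ α : V.ValueGroup,
      ∀ a ∈ K, V.valuation (z - a) ≤ V.valuation (z - a₀) → V.valuation (g.eval a) = α)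
    (G : Finset (Polynomial Ω)) (hG : ∀ g ∈ G, ∀ k, g.coeff k ∈ K) (M : ℕ) :
    ∃ a ∈ K, ∃ b ∈ K, b ≠ 0 ∧ V.valuation b = V.valuation (z - a) ∧
      ∀ g ∈ G, ∀ g' ∈ G, ∀ m m' : ℕ, m ≤ M → m' ≤ M → m ≠ m' → g.eval a ≠ 0 → g'.eval a ≠ 0 →
        V.valuation (g.eval a) * V.valuation b ^ m ≠
          V.valuation (g'.eval a) * V.valuation b ^ m' := by
  classical
  set E := Subfield.closure ((K : Set Ω) ∪ {z}) with hE
  have hKE : ∀ x ∈ K, x ∈ E := fun x hx => Subfield.subset_closure (Or.inl hx)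
  have hzE : z ∈ E := Subfield.subset_closure (Or.inr rfl)
  have hza : ∀ a ∈ K, z - a ≠ 0 := fun a ha h => hzK (by rw [sub_eq_zero.mp h]; exact ha)
  have hvza : ∀ a ∈ K, V.valuation (z - a) ≠ 0 := fun a ha => (_root_.map_ne_zero _).mpr (hza a ha)
  -- the constants from (3) and a common centre
  have h3' : ∀ g : Polynomial Ω, ∃ a₀ : Ω, ∃ α : V.ValueGroup, (∀ k, g.coeff k ∈ K) →
      a₀ ∈ K ∧ ∀ a ∈ K, V.valuation (z - a) ≤ V.valuation (z - a₀) →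
        V.valuation (g.eval a) = α := by
    intro g
    by_cases hg : ∀ k, g.coeff k ∈ K
    · obtain ⟨a₀, ha₀, α, h⟩ := h3 g hg
      exact ⟨a₀, α, fun _ => ⟨ha₀, h⟩⟩
    · exact ⟨0, 1, fun h => (hg h).elim⟩
  choose ctr α hctr using h3'
  obtain ⟨aS, haSK, haS⟩ : ∃ aS ∈ K, ∀ g ∈ G, V.valuation (z - aS) ≤ V.valuation (z - ctr g) := by
    by_cases hGne : G.Nonempty
    · obtain ⟨g₀, hg₀, hmin⟩ :=
        Finset.exists_min_image G (fun g => V.valuation (z - ctr g)) hGne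
      exact ⟨ctr g₀, (hctr g₀ (hG g₀ hg₀)).1, fun g hg => hmin g hg⟩
    · exact ⟨0, K.zero_mem, fun g hg => (hGne ⟨g, hg⟩).elim⟩
  have hconst : ∀ g ∈ G, ∀ a ∈ K, V.valuation (z - a) ≤ V.valuation (z - aS) →
      V.valuation (g.eval a) = α g := fun g hg a ha hle =>
    (hctr g (hG g hg)).2 a ha (hle.trans (haS g hg))
  -- the finitely many bad values
  let bad : Set V.ValueGroup :=
    ⋃ g ∈ G, ⋃ g' ∈ G, ⋃ q ∈ (Finset.range (M + 1)) ×ˢ (Finset.range (M + 1)),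
      {γ | γ ≠ 0 ∧ α g ≠ 0 ∧ α g' ≠ 0 ∧ q.1 ≠ q.2 ∧ α g * γ ^ q.1 = α g' * γ ^ q.2}
  have hbadfin : bad.Finite := by
    refine Set.Finite.biUnion G.finite_toSet fun g _ => ?_
    refine Set.Finite.biUnion G.finite_toSet fun g' _ => ?_
    refine Set.Finite.biUnion (Finset.finite_toSet _) fun q _ => ?_
    refine Set.Subsingleton.finite ?_
    rintro γ₁ ⟨h10, hα, hα', hq, h1⟩ γ₂ ⟨h20, -, -, -, h2⟩
    rcases Nat.lt_or_gt_of_ne hq with hij | hij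
    · obtain ⟨n, hn⟩ : ∃ n, q.2 = q.1 + n := ⟨q.2 - q.1, by omega⟩
      have hn0 : n ≠ 0 := by omega
      have key : ∀ γ : V.ValueGroup, γ ≠ 0 → α g * γ ^ q.1 = α g' * γ ^ q.2 →
          γ ^ n = α g / α g' := by
        intro γ hγ h
        rw [hn, pow_add, ← mul_assoc] at h
        have hγp : γ ^ q.1 ≠ 0 := pow_ne_zero _ hγ
        rw [eq_div_iff hα', mul_comm]
        have h' : α g * γ ^ q.1 = α g' * γ ^ n * γ ^ q.1 := by rw [h, mul_right_comm]
        exact (mul_right_cancel₀ hγp h').symm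
      have := (key γ₁ h10 h1).trans (key γ₂ h20 h2).symm
      exact (pow_left_strictMonoOn₀ hn0).injOn zero_le zero_le this
    · obtain ⟨n, hn⟩ : ∃ n, q.1 = q.2 + n := ⟨q.1 - q.2, by omega⟩
      have hn0 : n ≠ 0 := by omega
      have key : ∀ γ : V.ValueGroup, γ ≠ 0 → α g * γ ^ q.1 = α g' * γ ^ q.2 →
          γ ^ n = α g' / α g := by
        intro γ hγ h
        rw [hn, pow_add, ← mul_assoc] at h
        have hγp : γ ^ q.2 ≠ 0 := pow_ne_zero _ hγ
        rw [eq_div_iff hα, mul_comm]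
        have h' : α g * γ ^ n * γ ^ q.2 = α g' * γ ^ q.2 := by rw [← h, mul_right_comm]
        exact mul_right_cancel₀ hγp h'
      have := (key γ₁ h10 h1).trans (key γ₂ h20 h2).symm
      exact (pow_left_strictMonoOn₀ hn0).injOn zero_le zero_le this
  -- infinitely many values `v(z - a)` below `v(z - aS)`
  let vals : Set V.ValueGroup :=
    {γ | ∃ a ∈ K, V.valuation (z - a) = γ ∧ γ ≤ V.valuation (z - aS)}
  have hvalsinf : vals.Infinite := by
    intro hfin
    have hne : vals.Nonempty := ⟨_, aS, haSK, rfl, le_rfl⟩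
    obtain ⟨γ, hγ⟩ := Set.Finite.exists_minimal hfin hne
    obtain ⟨a, haK, hγa, hγle⟩ := hγ.1
    obtain ⟨a₁, ha₁K, hlt⟩ := exists_valuation_sub_lt V K hzK hval hres haK
    have hmem : V.valuation (z - a₁) ∈ vals :=
      ⟨a₁, ha₁K, rfl, (hlt.le.trans (hγa.le.trans hγle))⟩
    have := hγ.2 hmem (by rw [← hγa]; exact hlt.le)
    rw [← hγa] at this
    exact absurd hlt (not_lt.mpr this)
  obtain ⟨γ, ⟨a, haK, hγa, hγle⟩, hγbad⟩ := (hvalsinf.sdiff hbadfin).nonempty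
  obtain ⟨b, hbK, hvb⟩ := hval (z - a) (sub_mem hzE (hKE a haK)) (hza a haK)
  have hb0 : b ≠ 0 := by
    rintro rfl
    rw [map_zero] at hvb
    exact hvza a haK hvb
  refine ⟨a, haK, b, hbK, hb0, hvb.symm, ?_⟩
  intro g hg g' hg' m m' hm hm' hmm' hga hg'a heq
  have hγ0 : γ ≠ 0 := by rw [← hγa]; exact hvza a haK
  have hle : V.valuation (z - a) ≤ V.valuation (z - aS) := by rw [hγa]; exact hγle
  have hvg : V.valuation (g.eval a) = α g := hconst g hg a haK hle
  have hvg' : V.valuation (g'.eval a) = α g' := hconst g' hg' a haK hle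
  have hαg : α g ≠ 0 := by rw [← hvg]; exact (_root_.map_ne_zero _).mpr hga
  have hαg' : α g' ≠ 0 := by rw [← hvg']; exact (_root_.map_ne_zero _).mpr hg'a
  apply hγbad
  simp only [bad, Set.mem_iUnion, Set.mem_setOf_eq, Finset.mem_product, Finset.mem_range]
  refine ⟨g, hg, g', hg', (m, m'), ⟨by omega, by omega⟩, hγ0, hαg, hαg', hmm', ?_⟩
  rw [← hvg, ← hvg', ← hγa, hvb]
  exact heq

end Literature.AlgebraicGeometry.Resolution

end
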